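import Summits.QuantumFields.YangMills.Theorems.LuscherReductionTwistedTraceScalingBODefectSplit
import Summits.QuantumFields.YangMills.Theorems.LuscherReductionTwistedTraceScalingBODefectCoreRecord
import Summits.QuantumFields.YangMills.Theorems.LuscherReductionTwistedTraceScalingBODefectTailFP
import Summits.QuantumFields.YangMills.Theorems.LuscherReductionTwistedTraceScalingColourAverage
import Summits.QuantumFields.YangMills.Theorems.LuscherReductionTwistedTraceScalingBODefectRecordSplit
import HarnessLib

/-!
# The record defect split into its four pieces — GENERAL CAP CONSTANT, ORBIT-DISTANCE output window

Support file for the crux `NearFlatRatioLaw` (line `ratepack_v2`, stub `stub_hODpot_A`; successor step (E) of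
`Cruxes/NearFlatRatioLaw/Lines/ratepack-v7-moments-g18.md` §14; memo v8 (g19)): lane A's `…BODefectRecordSplit.record_defect_split` VERBATIM except that the cap
constant `43` is a parameter `Kc` and the inner set's slow window is `{orbitDist(slowMean U) ≤ D·β^{-s}}` (the output window of
`…CoreDefectRecordOrbitMomentsQuasi` / `…TailPieceK`; `hsupp` in the orbit-distance form of `…RecordSupportK.recordChi_support_K`).
★★ `record_defect_split_K` — `∫(𝟙_S(F/w − B))²w ≤ 2∫𝟙_{S_in}(K_core/w − B)²w + 2∫𝟙_{S_in}K_tail²/w + 2∫𝟙_{S_out}F²/w + 2∫𝟙_{S_out}B²w`.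
-/

set_option autoImplicit false

noncomputable section

open MeasureTheory Filter Topology Real
open scoped BigOperators
open Literature.MathematicalPhysics.QuantumFieldTheory
open Literature.MathematicalPhysics.QuantumLattice

namespace Summit.QuantumFields.YangMills.Theorems.FemtoTransferGap.TwoLattice.ConstTube

open Summit.QuantumFields.YangMills.Theorems.FemtoTransferGap
open Summit.QuantumFields.YangMills.Theorems.FemtoTransferGap.TwoLattice
open Summit.QuantumFields.YangMills.Theorems.FemtoTransferGap.TwoLattice.Avg
open Summit.QuantumFields.YangMills.Theorems.FemtoTransferGap.TwoLattice.Stiff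
open Summit.QuantumFields.YangMills.Theorems.FemtoTransferGap.TwoLattice.GnChart

variable {L : ℕ} [NeZero L]

set_option maxHeartbeats 1600000 in
-- large record expressions.
/-- ★★ **THE DEFECT OF RECORD SPLIT INTO ITS FOUR PIECES** (see the module docstring). [cite: Luscher1983, §3] -/
theorem record_defect_split_K (β : ℝ) {s Kc M D : ℝ}
    {φ : GaugeConfig 3 1 SU2 → ℝ} (hφm : Measurable φ) {Cφ : ℝ} (hCφ : ∀ u, |φ u| ≤ Cφ)
    {ψ : GaugeConfig 3 1 SU2 → ℝ} (hψm : Measurable ψ) {Cψ : ℝ} (hCψ : ∀ u, |ψ u| ≤ Cψ)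
    {w₀ : ℝ} (hw₀ : 0 < w₀) (hwS : ∀ U, (recordChi L s Kc M β) U ≠ 0 → w₀ ≤ softWeight (recordChi L s Kc M β) U)
    (hsupp : ∀ U, (recordChi L s Kc M β) U ≠ 0 → U ∈ orthoTubeSet L ∧ orbitDist (slowMean L U) ≤ D * powScale s β) :
    ∫ U, ({U : GaugeConfig 3 L SU2 | (recordChi L s Kc M β) U ≠ 0}.indicator (fun U => (∫ V, avgKernel β U V * boFun L φ (fun x : LinkSpace L => {x : LinkSpace L | linkCurry x ∈ capBalancedSet L}.indicator (fun _ => (1 : ℝ)) x * frozenProfile L (fun β' => stiffGaussExp L (β' / 2) β') (fun β' => min (1 / 40) (powScale (1 / 2) β' * btLog β')) β x) V ∂configMeasure SU2 L) / softWeight (recordChi L s Kc M β) U - boFun L ψ (fun x : LinkSpace L => {x : LinkSpace L | linkCurry x ∈ capBalancedSet L}.indicator (fun _ => (1 : ℝ)) x * frozenProfile L (fun β' => stiffGaussExp L (β' / 2) β') (fun β' => min (1 / 40) (powScale (1 / 2) β' * btLog β')) β x) U) U) ^ 2 * softWeight (recordChi L s Kc M β) U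
        ∂configMeasure SU2 L ≤
      2 * ∫ U, {U : GaugeConfig 3 L SU2 | U ∈ orthoTubeSet L ∧ (recordChi L s Kc M β) U ≠ 0 ∧ ‖relLinkVec L U‖ ≤ (min (1 / 40) (powScale (1 / 2) β * btLog β)) / 12 ∧ slowMean L U ∈ {u : GaugeConfig 3 1 SU2 | orbitDist u ≤ (D * powScale s β)}}.indicator (fun _ => (1 : ℝ)) U * (((fun U : GaugeConfig 3 L SU2 => (fpZ (powScale 1 β))⁻¹ * ∫ u, φ u * (∫ c, fpFibreTransfer L β (fun x : LinkSpace L => {x : LinkSpace L | linkCurry x ∈ capBalancedSet L}.indicator (fun _ => (1 : ℝ)) x * frozenProfile L (fun β' => stiffGaussExp L (β' / 2) β') (fun β' => min (1 / 40) (powScale (1 / 2) β' * btLog β')) β x) (coreWeight L (powScale 1 β) (5 * (powScale (1 / 2) β * btLog β ^ 2))) (gaugeTransform (fun _ : Site 3 L => c⁻¹) U) u ∂haarProbability SU2) ∂configMeasure SU2 1) U / softWeight (recordChi L s Kc M β) U - boFun L ψ (fun x : LinkSpace L => {x : LinkSpace L | linkCurry x ∈ capBalancedSet L}.indicator (fun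 _ => (1 : ℝ)) x * frozenProfile L (fun β' => stiffGaussExp L (β' / 2) β') (fun β' => min (1 / 40) (powScale (1 / 2) β' * btLog β')) β x) U) ^ 2 * softWeight (recordChi L s Kc M β) U) ∂configMeasure SU2 L +
      2 * ∫ U, {U : GaugeConfig 3 L SU2 | U ∈ orthoTubeSet L ∧ (recordChi L s Kc M β) U ≠ 0 ∧ ‖relLinkVec L U‖ ≤ (min (1 / 40) (powScale (1 / 2) β * btLog β)) / 12 ∧ slowMean L U ∈ {u : GaugeConfig 3 1 SU2 | orbitDist u ≤ (D * powScale s β)}}.indicator (fun _ => (1 : ℝ)) U * ((fun U : GaugeConfig 3 L SU2 => (fpZ (powScale 1 β))⁻¹ * ∫ u, φ u * (∫ c, fpFibreTransfer L β (fun x : LinkSpace L => {x : LinkSpace L | linkCurry x ∈ capBalancedSet L}.indicator (fun _ => (1 : ℝ)) x * frozenProfile L (fun β' => stiffGaussExp L (β' / 2) β') (fun β' => min (1 / 40) (powScale (1 / 2) β' * btLog β')) β x) (tailWeight L (powScale 1 β) (5 * (powScale (1 / 2) β * btLog β ^ 2))) (gaugeTransform (fun _ : Site 3 L => c⁻¹)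 U) u ∂haarProbability SU2) ∂configMeasure SU2 1) U ^ 2 / softWeight (recordChi L s Kc M β) U) ∂configMeasure SU2 L +
      2 * ∫ U, (orthoTubeSet L ∩ {U | (recordChi L s Kc M β) U ≠ 0} ∩ {U | (min (1 / 40) (powScale (1 / 2) β * btLog β)) / 12 < ‖relLinkVec L U‖}).indicator (fun _ => (1 : ℝ)) U *
        ((∫ V, avgKernel β U V * boFun L φ (fun x : LinkSpace L => {x : LinkSpace L | linkCurry x ∈ capBalancedSet L}.indicator (fun _ => (1 : ℝ)) x * frozenProfile L (fun β' => stiffGaussExp L (β' / 2) β') (fun β' => min (1 / 40) (powScale (1 / 2) β' * btLog β')) β x) V ∂configMeasure SU2 L) ^ 2 / softWeight (recordChi L s Kc M β) U) ∂configMeasure SU2 L +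
      2 * ∫ U, (orthoTubeSet L ∩ {U | (recordChi L s Kc M β) U ≠ 0} ∩ {U | (min (1 / 40) (powScale (1 / 2) β * btLog β)) / 12 < ‖relLinkVec L U‖}).indicator (fun _ => (1 : ℝ)) U *
        (boFun L ψ (fun x : LinkSpace L => {x : LinkSpace L | linkCurry x ∈ capBalancedSet L}.indicator (fun _ => (1 : ℝ)) x * frozenProfile L (fun β' => stiffGaussExp L (β' / 2) β') (fun β' => min (1 / 40) (powScale (1 / 2) β' * btLog β')) β x) U ^ 2 * softWeight (recordChi L s Kc M β) U) ∂configMeasure SU2 L := by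
  haveI : IsProbabilityMeasure (haarProbability SU2) := ⟨by simpa [haarProbability] using Measure.haarMeasure_self (G := SU2) (K₀ := ⊤)⟩
  obtain ⟨hχm, hχ1, hχ0, -⟩ := recordChi_props (L := L) s Kc M β
  obtain ⟨hwm, hwb, hw0, -⟩ := softWeight_recordChi_props (L := L) s Kc M β
  -- the profile `Ω_c`: measurable, `|Ω_c| ≤ 1`
  have hqfm : ∀ β', Measurable ((fun β' => stiffGaussExp L (β' / 2) β') β') := fun β' => measurable_stiffGaussExp _ _
  have hqf0 : ∀ β' x, 0 ≤ (fun β' => stiffGaussExp L (β' / 2) β') β' x := fun β' x => stiffGaussExp_nonneg _ _ x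
  have hΩGm : Measurable (frozenProfile L (fun β' => stiffGaussExp L (β' / 2) β') (fun β' => min (1 / 40) (powScale (1 / 2) β' * btLog β')) β) := measurable_frozenProfile hqfm _ β
  have hΩG0 : ∀ x, 0 ≤ frozenProfile L (fun β' => stiffGaussExp L (β' / 2) β') (fun β' => min (1 / 40) (powScale (1 / 2) β' * btLog β')) β x := fun x => (frozenProfile_mem_Icc hqf0 _ β x).1
  have hΩG1 : ∀ x, |frozenProfile L (fun β' => stiffGaussExp L (β' / 2) β') (fun β' => min (1 / 40) (powScale (1 / 2) β' * btLog β')) β x| ≤ 1 := abs_frozenProfile_le hqf0 _ β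
  have hΩm : Measurable (fun x : LinkSpace L => {x : LinkSpace L | linkCurry x ∈ capBalancedSet L}.indicator (fun _ => (1 : ℝ)) x * frozenProfile L (fun β' => stiffGaussExp L (β' / 2) β') (fun β' => min (1 / 40) (powScale (1 / 2) β' * btLog β')) β x) := measurable_capRestrict (L := L) hΩGm
  have hΩ1 : ∀ x, |(fun x : LinkSpace L => {x : LinkSpace L | linkCurry x ∈ capBalancedSet L}.indicator (fun _ => (1 : ℝ)) x * frozenProfile L (fun β' => stiffGaussExp L (β' / 2) β') (fun β' => min (1 / 40) (powScale (1 / 2) β' * btLog β')) β x) x| ≤ 1 := fun x => (capRestrict_mem (L := L) hΩG0 hΩG1 x).2.2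
  have hWcm := measurable_coreWeight (L := L) (powScale 1 β) (5 * (powScale (1 / 2) β * btLog β ^ 2))
  have hWtm := measurable_tailWeight (L := L) (powScale 1 β) (5 * (powScale (1 / 2) β * btLog β ^ 2))
  set Ωc : LinkSpace L → ℝ := (fun x : LinkSpace L => {x : LinkSpace L | linkCurry x ∈ capBalancedSet L}.indicator (fun _ => (1 : ℝ)) x * frozenProfile L (fun β' => stiffGaussExp L (β' / 2) β') (fun β' => min (1 / 40) (powScale (1 / 2) β' * btLog β')) β x) with hΩcdef
  set χ := (recordChi L s Kc M β) with hχdef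
  set w := softWeight (recordChi L s Kc M β) with hwdef
  set Zi : ℝ := (fpZ (powScale 1 β))⁻¹ with hZidef
  have hZi0 : 0 ≤ Zi := by rw [hZidef]; exact (inv_pos.2 (fpZ_pos (powScale_pos 1 β))).le
  -- `F`, `K_core`, `K_tail`, `B`
  set F : GaugeConfig 3 L SU2 → ℝ := fun U => ∫ V, avgKernel β U V * boFun L φ Ωc V ∂configMeasure SU2 L with hFdef
  set Kco : GaugeConfig 3 L SU2 → ℝ := (fun U : GaugeConfig 3 L SU2 => (fpZ (powScale 1 β))⁻¹ * ∫ u, φ u * (∫ c, fpFibreTransfer L β (fun x : LinkSpace L => {x : LinkSpace L | linkCurry x ∈ capBalancedSet L}.indicator (fun _ => (1 : ℝ)) x * frozenProfile L (fun β' => stiffGaussExp L (β' / 2) β') (fun β' => min (1 / 40) (powScale (1 / 2) β' * btLog β')) β x) (coreWeight L (powScale 1 β) (5 * (powScale (1 / 2) β * btLog β ^ 2))) (gaugeTransform (fun _ : Site 3 L => c⁻¹) U) u ∂haarProbability SU2) ∂configMeasure SU2 1) with hKcodef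
  set Kt : GaugeConfig 3 L SU2 → ℝ := (fun U : GaugeConfig 3 L SU2 => (fpZ (powScale 1 β))⁻¹ * ∫ u, φ u * (∫ c, fpFibreTransfer L β (fun x : LinkSpace L => {x : LinkSpace L | linkCurry x ∈ capBalancedSet L}.indicator (fun _ => (1 : ℝ)) x * frozenProfile L (fun β' => stiffGaussExp L (β' / 2) β') (fun β' => min (1 / 40) (powScale (1 / 2) β' * btLog β')) β x) (tailWeight L (powScale 1 β) (5 * (powScale (1 / 2) β * btLog β ^ 2))) (gaugeTransform (fun _ : Site 3 L => c⁻¹) U) u ∂haarProbability SU2) ∂configMeasure SU2 1) with hKtdef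
  set B : GaugeConfig 3 L SU2 → ℝ := boFun L ψ Ωc with hBdef
  have hbom := measurable_boFun L hφm hΩm
  have hbob : ∀ V, |boFun L φ Ωc V| ≤ Cφ * 1 := fun V => abs_boFun_le L hCφ hΩ1 V
  obtain ⟨hFm, ⟨CF, hCF⟩, -⟩ := integral_avgKernel_mul_props (L := L) β hbom hbob
  have hBm : Measurable B := measurable_boFun L hψm hΩm
  have hCB : ∀ U, |B U| ≤ Cψ * 1 := fun U => abs_boFun_le L hCψ hΩ1 U
  have hKcm : Measurable Kco := measurable_coreTransferApply (L := L) β hΩm hWcm hφm Zi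
  have hKtm : Measurable Kt := measurable_coreTransferApply (L := L) β hΩm hWtm hφm Zi
  -- uniform bounds on `K_core`, `K_tail`
  have hCφ0 : 0 ≤ Cφ := (abs_nonneg _).trans (hCφ 1)
  have hKbound : ∀ {W : (Site 3 L → SU2) → ℝ}, (∀ g, |W g| ≤ 1) → ∃ CK : ℝ, ∀ U,
      |Zi * ∫ u, φ u * (∫ c, fpFibreTransfer L β Ωc W (gaugeTransform (fun _ : Site 3 L => c⁻¹) U) u ∂haarProbability SU2) ∂configMeasure SU2 1| ≤ CK := by
    intro W hW
    obtain ⟨Bf, hBf⟩ := abs_fpFibreTransfer_le' (L := L) β hΩ1 hW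
    have hBf0 : 0 ≤ Bf := (abs_nonneg _).trans (hBf 1 1)
    refine ⟨Zi * (Cφ * Bf), fun U => ?_⟩
    have hc : ∀ u, |∫ c, fpFibreTransfer L β Ωc W (gaugeTransform (fun _ : Site 3 L => c⁻¹) U) u ∂haarProbability SU2| ≤ Bf := fun u => by
      have h := norm_integral_le_of_norm_le_const (μ := haarProbability SU2) (f := fun c => fpFibreTransfer L β Ωc W (gaugeTransform (fun _ : Site 3 L => c⁻¹) U) u)
        (C := Bf) (ae_of_all _ fun c => by rw [Real.norm_eq_abs]; exact hBf _ _)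
      rw [probReal_univ, mul_one, Real.norm_eq_abs] at h; exact h
    have hi : |∫ u, φ u * (∫ c, fpFibreTransfer L β Ωc W (gaugeTransform (fun _ : Site 3 L => c⁻¹) U) u ∂haarProbability SU2) ∂configMeasure SU2 1| ≤ Cφ * Bf := by
      have h := norm_integral_le_of_norm_le_const (μ := configMeasure SU2 1)
        (f := fun u => φ u * (∫ c, fpFibreTransfer L β Ωc W (gaugeTransform (fun _ : Site 3 L => c⁻¹) U) u ∂haarProbability SU2)) (C := Cφ * Bf)
        (ae_of_all _ fun u => by rw [Real.norm_eq_abs, abs_mul]; exact mul_le_mul (hCφ u) (hc u) (abs_nonneg _) hCφ0)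
      rw [probReal_univ, mul_one, Real.norm_eq_abs] at h; exact h
    rw [abs_mul, abs_of_nonneg hZi0]
    exact mul_le_mul_of_nonneg_left hi hZi0
  obtain ⟨CKc, hCKc⟩ := hKbound (W := (coreWeight L (powScale 1 β) (5 * (powScale (1 / 2) β * btLog β ^ 2)))) (abs_coreWeight_le (L := L) _ _)
  obtain ⟨CKt, hCKt⟩ := hKbound (W := (tailWeight L (powScale 1 β) (5 * (powScale (1 / 2) β * btLog β ^ 2)))) (abs_tailWeight_le (L := L) _ _)
  obtain ⟨Cw, hCw⟩ : ∃ Cw : ℝ, ∀ U, |w U| ≤ Cw := ⟨_, hwb⟩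
  -- the sets
  set S : Set (GaugeConfig 3 L SU2) := {U | χ U ≠ 0} with hSdef
  set Sin : Set (GaugeConfig 3 L SU2) := {U : GaugeConfig 3 L SU2 | U ∈ orthoTubeSet L ∧ (recordChi L s Kc M β) U ≠ 0 ∧ ‖relLinkVec L U‖ ≤ (min (1 / 40) (powScale (1 / 2) β * btLog β)) / 12 ∧ slowMean L U ∈ {u : GaugeConfig 3 1 SU2 | orbitDist u ≤ (D * powScale s β)}} with hSindef
  set Sout : Set (GaugeConfig 3 L SU2) := orthoTubeSet L ∩ {U | χ U ≠ 0} ∩ {U | (min (1 / 40) (powScale (1 / 2) β * btLog β)) / 12 < ‖relLinkVec L U‖} with hSoutdef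
  have hSm : MeasurableSet S := (hχm (measurableSet_singleton 0)).compl
  have hSinm : MeasurableSet Sin := by
    have h1 : MeasurableSet {U : GaugeConfig 3 L SU2 | ‖relLinkVec L U‖ ≤ (min (1 / 40) (powScale (1 / 2) β * btLog β)) / 12} := measurableSet_le (measurable_relLinkVec L).norm measurable_const
    have h2 : MeasurableSet {U : GaugeConfig 3 L SU2 | slowMean L U ∈ {u : GaugeConfig 3 1 SU2 | orbitDist u ≤ (D * powScale s β)}} :=
      (measurableSet_le measurable_orbitDist measurable_const).preimage (measurable_slowMean L)
    have e : Sin = orthoTubeSet L ∩ S ∩ {U : GaugeConfig 3 L SU2 | ‖relLinkVec L U‖ ≤ (min (1 / 40) (powScale (1 / 2) β * btLog β)) / 12} ∩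
        {U : GaugeConfig 3 L SU2 | slowMean L U ∈ {u : GaugeConfig 3 1 SU2 | orbitDist u ≤ (D * powScale s β)}} := by
      ext U; simp only [hSindef, hSdef, Set.mem_setOf_eq, Set.mem_inter_iff]; tauto
    rw [e]; exact (((measurableSet_orthoTubeSet L).inter hSm).inter h1).inter h2
  have hsub : Sin ⊆ S := fun U hU => hU.2.1
  have hdiff : S \ Sin ⊆ Sout := by
    intro U hU
    obtain ⟨hUS, hUn⟩ := hU
    have hχU : χ U ≠ 0 := hUS
    obtain ⟨hoT, hslow⟩ := hsupp U hχU
    refine ⟨⟨hoT, hχU⟩, ?_⟩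
    simp only [Set.mem_setOf_eq]
    by_contra hle
    exact hUn ⟨hoT, hχU, not_lt.mp hle, hslow⟩
  -- the FP decomposition `F = K_core + K_tail` (everywhere)
  have hsplit : ∀ U ∈ Sin, F U = Kco U + Kt U := fun U _ => by
    simp only [hFdef, hKcodef, hKtdef]
    exact transferApply_boFun_eq_core_add_tail (L := L) β (powScale_pos 1 β) (5 * (powScale (1 / 2) β * btLog β ^ 2)) hφm hCφ hΩm hΩ1 U
  -- the abstract split
  have hmain := sq_integral_defect_split_le (μ := configMeasure SU2 L) hFm hKcm hKtm hBm hwm hCF hCKc hCKt hCB hCw hSm hSinm hsub hw₀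
    (fun U hU => hwS U hU) hsplit
  -- `S ∖ S_in ⊆ S_out` in the last two pieces
  have hw0' : ∀ U, 0 ≤ w U := hw0
  have h3 : ∫ U, (S \ Sin).indicator (fun _ => (1 : ℝ)) U * (F U ^ 2 / w U) ∂configMeasure SU2 L ≤ ∫ U, Sout.indicator (fun _ => (1 : ℝ)) U * (F U ^ 2 / w U) ∂configMeasure SU2 L := by
    have hSoutm : MeasurableSet Sout :=
      ((measurableSet_orthoTubeSet L).inter hSm).inter (measurableSet_lt measurable_const (measurable_relLinkVec L).norm)
    refine integral_mono_of_nonneg (ae_of_all _ fun U => mul_nonneg (Set.indicator_nonneg (fun _ _ => zero_le_one) _) (div_nonneg (sq_nonneg _) (hw0' U))) ?_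
      (ae_of_all _ fun U => indicator_one_mul_le_of_subset hdiff (fun U => div_nonneg (sq_nonneg _) (hw0' U)) U)
    refine integrable_indicator_mul_of_bound _ hSoutm ((hFm.pow_const 2).div hwm) (C := CF ^ 2 / w₀) fun U hU => ?_
    have hwU : w₀ ≤ w U := hwS U hU.1.2
    rw [abs_div, abs_of_nonneg (hw0' U), abs_pow]
    exact div_le_div₀ (sq_nonneg _) (pow_le_pow_left₀ (abs_nonneg _) (hCF U) 2) hw₀ hwU
  have h4 : ∫ U, (S \ Sin).indicator (fun _ => (1 : ℝ)) U * (B U ^ 2 * w U) ∂configMeasure SU2 L ≤ ∫ U, Sout.indicator (fun _ => (1 : ℝ)) U * (B U ^ 2 * w U) ∂configMeasure SU2 L := by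
    have hSoutm : MeasurableSet Sout :=
      ((measurableSet_orthoTubeSet L).inter hSm).inter (measurableSet_lt measurable_const (measurable_relLinkVec L).norm)
    have hCψ0 : 0 ≤ Cψ * 1 := (abs_nonneg _).trans (hCB 1)
    have hCw0 : 0 ≤ Cw := (abs_nonneg _).trans (hCw 1)
    refine integral_mono_of_nonneg (ae_of_all _ fun U => mul_nonneg (Set.indicator_nonneg (fun _ _ => zero_le_one) _) (mul_nonneg (sq_nonneg _) (hw0' U))) ?_
      (ae_of_all _ fun U => indicator_one_mul_le_of_subset hdiff (fun U => mul_nonneg (sq_nonneg _) (hw0' U)) U)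
    refine integrable_indicator_mul_of_bound _ hSoutm ((hBm.pow_const 2).mul hwm) (C := (Cψ * 1) ^ 2 * Cw) fun U _ => ?_
    rw [abs_mul, abs_pow, abs_of_nonneg (hw0' U)]
    exact mul_le_mul (pow_le_pow_left₀ (abs_nonneg _) (hCB U) 2) ((le_abs_self _).trans (hCw U)) (hw0' U) (sq_nonneg _)
  have hE : ∀ U, (S.indicator (fun U => F U / w U - B U) U) ^ 2 * w U = ({U : GaugeConfig 3 L SU2 | (recordChi L s Kc M β) U ≠ 0}.indicator (fun U => (∫ V, avgKernel β U V * boFun L φ (fun x : LinkSpace L => {x : LinkSpace L | linkCurry x ∈ capBalancedSet L}.indicator (fun _ => (1 : ℝ)) x * frozenProfile L (fun β' => stiffGaussExp L (β' / 2) β') (fun β' => min (1 / 40) (powScale (1 / 2) β' * btLog β')) β x) V ∂configMeasure SU2 L) / softWeight (recordChi L s Kc M β) U - boFun L ψ (fun x : LinkSpace L => {x : LinkSpace L | linkCurry x ∈ capBalancedSet L}.indicator (fun _ => (1 : ℝ)) x * frozenProfile L (fun β' => stiffGaussExp L (β' / 2) β') (fun β' => min (1 / 40) (powScale (1 / 2)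 β' * btLog β')) β x) U) U) ^ 2 * softWeight (recordChi L s Kc M β) U := fun U => rfl
  calc _ = ∫ U, (S.indicator (fun U => F U / w U - B U) U) ^ 2 * w U ∂configMeasure SU2 L := rfl
    _ ≤ _ := hmain
    _ ≤ _ := by linarith [h3, h4]

end Summit.QuantumFields.YangMills.Theorems.FemtoTransferGap.TwoLattice.ConstTube

end
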